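import Summits.NavierStokesRegularity.OSWSelfSimilar.SheetRGeneratorEvenDense
import HarnessLib

/-!
# SHEET-ℝ frame, EVEN ZERO-MASS class `E⁺₀`: even zero-mass `C²` profiles WITH WEIGHTED DECAY lie in the domain of Kato's closed operator
# `T⁺ = generatorEven` — for EVERY (S1⁺) datum (the regularity binder `h⁺ ∈ D(T⁺*)` of the (P10)⁺ record word, discharged at function level)

HONEST FRAMING (cell ns-blowup GROUP B / zone Z3, case Z3-SR-SPEC EVEN half, HYPOTHESIS-LEDGER v2.3 row (P10)⁺ record half; 1-D MODEL certificate frame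
(viscous gCLM/OSW sheet on the line); not Euler/NS; «violates: none — MODEL»). Nothing here asserts that a profile exists; the (S1⁺) Gårding datum
`h : GardingDataKE …` is the HYPOTHESIS as everywhere in the even chain (any drift/potential `d, V` with the measurability/growth fields `|d| ≤ D₀ + D₁|ξ|`,
`|V| ≤ V₀`, any bounded `K : EspE →L L²_w`). WHY (cert-1 g10; companion of selfsim g17's `SheetRLinearisedStabilityEvenRecord` — interface tier, binder `hf`/`hdom : h⁺ ∈ D(T⁺*)` — and of cert-1 g10's
`SheetRLinearisedStabilityEvenEndToEnd` — (D2) interface literals): the even spectral word of record states its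
far datum `MixedFarDatum (resolventEven … hS1) …` at the CENTRE datum, while the linearised flow of the (P10)⁺ word is generated by `T⁺*` at the STAR datum; so
`h⁺ ∈ D(T⁺*)` is not read off the far datum there (selfsim g16's `mem_domain_generatorEven_of_mixedFarDatum` needs the SAME datum) and must be proved at function
level. This file is selfsim g14's `SheetRGeneratorEvenDense.cplxE_jmapE_mem_domain` with COMPACT SUPPORT REPLACED BY WEIGHTED DECAY:
* §1 `memLp_image_of_C2` — for `φ ∈ C²` with `∫w φ², ∫w φ′², ∫w (ξφ′)², ∫w φ″² < ∞`: the local image `−φ″ + dφ′ + Vφ ∈ L²_w`;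
* §2 `linForm_eq_integral_of_C2` — against every PARITY-FREE compactly supported test: `linForm L d V φ φ′ v v₁ = ∫ w·(−φ″ + dφ′ + Vφ)·v` (one integration by
  parts, cert-5's `integral_deriv_mul_testAny`; the test carries the compact support, `φ` only the weights);
* §3 `exists_espE_of_C1` — an even zero-mass `C¹` profile with `∫w φ², ∫w φ′² < ∞` is `profile P` of some `P ∈ EspE` with `derE P = φ′` a.e. (cert-5 g9
  `exists_espE_of_profile`), and its `L²_w` class is `ιEE P`;
* §4 **`realE_mem_domain_generatorEven_of_smooth`** — for such `φ` (`C²`, even, `∫φ = 0`, the four weights) and its class `g ∈ WevenZ`: `realE hL g _ ∈ D(T⁺)` for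
  every datum and every base point — weak image = the even zero-mass correction (`SheetREvenZeroMassCorrection`) of `−φ″ + dφ′ + Vφ + K P`, `mem_domain_of_weakE`.
No definition, no named fact, no instance, no notation. WHAT THIS IS NOT: not NS; no number of record moves; nothing about the lift of record itself (its `C²`
weights are a separate, purely calculus file).
-/

noncomputable section

namespace Summit.NavierStokesRegularity.OSWSelfSimilar
namespace SheetRGeneratorEvenSmoothDomain

open _root_.MeasureTheory _root_.Set _root_.Filter _root_.Real Literature.Analysis.Fourier SheetRWeakProfilePV SheetRWeakToStrong
  SheetREnergyClass SheetRWeightedMeasure SheetREnergySpace SheetRLinearisedTests SheetRTestSpace SheetRLinearisedFormBounds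
  SheetRComplexPivot SheetROddClass SheetREvenTests SheetREvenEnergySpace SheetREvenForms SheetREvenPairUniqueness
  SheetREvenClass SheetRResolventEvenClass SheetRGeneratorEvenWeak SheetREvenEnergySpaceOf SheetRGeneratorOddDense SheetREvenZeroMassCorrection
  SheetRGeneratorEvenDense SheetRWeakEigenReal SheetRSpectrumOddAssemblyReal Literature.Analysis.OperatorTheory Complex
open scoped Topology ENNReal InnerProductSpace ContDiff

variable {L : ℝ} {d V : ℝ → ℝ} {D₀ D₁ V₀ c m : ℝ}

/-! ### §1 The local image of a `C²` profile with weighted decay -/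

/-- **`−φ″ + dφ′ + Vφ ∈ L²_w`** for `φ ∈ C²` with `∫w φ², ∫w φ′², ∫w (ξφ′)², ∫w φ″² < ∞` (`|d| ≤ D₀ + D₁|ξ|`, `|V| ≤ V₀`). [folklore] -/
theorem memLp_image_of_C2 (hdm : AEStronglyMeasurable d volume) (hVm : AEStronglyMeasurable V volume)
    (hd : ∀ ξ, |d ξ| ≤ D₀ + D₁ * |ξ|) (hV : ∀ ξ, |V ξ| ≤ V₀) {φ : ℝ → ℝ} (hφ : ContDiff ℝ 2 φ)
    (hw0 : Integrable fun y => (L ^ 2 + y ^ 2) * φ y ^ 2) (hw1 : Integrable fun y => (L ^ 2 + y ^ 2) * deriv φ y ^ 2)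
    (hw1' : Integrable fun y => (L ^ 2 + y ^ 2) * (y * deriv φ y) ^ 2) (hw2 : Integrable fun y => (L ^ 2 + y ^ 2) * deriv (deriv φ) y ^ 2) :
    MemLp (fun y => -deriv (deriv φ) y + d y * deriv φ y + V y * φ y) 2 (μw L) := by
  have hφ1 : ContDiff ℝ 1 (deriv φ) := (contDiff_succ_iff_deriv.1 hφ).2.2
  have hc0 : Continuous φ := hφ.continuous
  have hc1 : Continuous (deriv φ) := hφ1.continuous
  have hc2 : Continuous (deriv (deriv φ)) := hφ1.continuous_deriv le_rfl
  have hmeas : AEStronglyMeasurable (fun y => -deriv (deriv φ) y + d y * deriv φ y + V y * φ y) volume :=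
    ((hc2.aestronglyMeasurable.neg).add (hdm.mul hc1.aestronglyMeasurable)).add (hVm.mul hc0.aestronglyMeasurable)
  refine memLp_W hmeas ?_
  have hdom : Integrable fun y => (L ^ 2 + y ^ 2) *
      (3 * deriv (deriv φ) y ^ 2 + 6 * D₀ ^ 2 * deriv φ y ^ 2 + 6 * D₁ ^ 2 * (y * deriv φ y) ^ 2 + 3 * V₀ ^ 2 * φ y ^ 2) := by
    have h := (hw2.const_mul 3).add (((hw1.const_mul (6 * D₀ ^ 2)).add (hw1'.const_mul (6 * D₁ ^ 2))).add (hw0.const_mul (3 * V₀ ^ 2)))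
    refine h.congr (Eventually.of_forall fun y => ?_)
    simp only [Pi.add_apply]
    ring
  refine hdom.mono' ((by fun_prop : AEStronglyMeasurable (fun y : ℝ => L ^ 2 + y ^ 2) volume).mul (hmeas.pow 2)) ?_
  refine Eventually.of_forall fun y => ?_
  have hw : 0 ≤ L ^ 2 + y ^ 2 := by positivity
  rw [Real.norm_eq_abs, abs_mul, abs_of_nonneg hw, abs_of_nonneg (sq_nonneg _)]
  refine mul_le_mul_of_nonneg_left ?_ hw
  -- `(dφ′)² ≤ (D₀ + D₁|y|)²φ′² ≤ 2D₀²φ′² + 2D₁²(yφ′)²`, `(Vφ)² ≤ V₀²φ²`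
  have hb : (d y * deriv φ y) ^ 2 ≤ 2 * D₀ ^ 2 * deriv φ y ^ 2 + 2 * D₁ ^ 2 * (y * deriv φ y) ^ 2 := by
    have h1 : |d y| ^ 2 ≤ (D₀ + D₁ * |y|) ^ 2 := pow_le_pow_left₀ (abs_nonneg _) (hd y) 2
    have h2 : (D₀ + D₁ * |y|) ^ 2 ≤ 2 * D₀ ^ 2 + 2 * D₁ ^ 2 * y ^ 2 := by
      nlinarith [sq_nonneg (D₀ - D₁ * |y|), sq_abs y]
    rw [sq_abs] at h1
    nlinarith [h1.trans h2, sq_nonneg (deriv φ y)]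
  have hc : (V y * φ y) ^ 2 ≤ V₀ ^ 2 * φ y ^ 2 := by
    have h1 : |V y| ^ 2 ≤ V₀ ^ 2 := pow_le_pow_left₀ (abs_nonneg _) (hV y) 2
    rw [sq_abs] at h1
    nlinarith [h1, sq_nonneg (φ y)]
  nlinarith [hb, hc, sq_nonneg (-deriv (deriv φ) y - d y * deriv φ y), sq_nonneg (-deriv (deriv φ) y - V y * φ y),
    sq_nonneg (d y * deriv φ y - V y * φ y)]

/-! ### §2 The weak form of the local operator on a `C²` profile, against parity-free tests -/

/-- **`linForm L d V φ φ′ v v₁ = ∫ w·(−φ″ + dφ′ + Vφ)·v`** for `φ ∈ C²` with `∫w φ², ∫w φ′² < ∞` and local image in `L²_w`, against every compactly supported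
PARITY-FREE test (the generalisation of `SheetREvenZeroMassCorrection.linForm_smooth_eq_integral_any` off compact support: one integration by parts,
`integral_deriv_mul_testAny`). [folklore] -/
theorem linForm_eq_integral_of_C2 (hL : 0 < L) (hdm : AEStronglyMeasurable d volume) (hVm : AEStronglyMeasurable V volume)
    (hD₁ : 0 ≤ D₁) (hd : ∀ ξ, |d ξ| ≤ D₀ + D₁ * |ξ|) (hV : ∀ ξ, |V ξ| ≤ V₀) {φ : ℝ → ℝ} (hφ : ContDiff ℝ 2 φ)
    (hw0 : Integrable fun y => (L ^ 2 + y ^ 2) * φ y ^ 2) (hw1 : Integrable fun y => (L ^ 2 + y ^ 2) * deriv φ y ^ 2)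
    (hq : MemLp (fun y => -deriv (deriv φ) y + d y * deriv φ y + V y * φ y) 2 (μw L))
    {v v₁ : ℝ → ℝ} (hv : IsCompactTestAny v v₁) :
    linForm L d V φ (deriv φ) v v₁ = ∫ y, (L ^ 2 + y ^ 2) * ((-deriv (deriv φ) y + d y * deriv φ y + V y * φ y) * v y) := by
  obtain ⟨hvc, -, -, hvK⟩ := basic_of_any hv
  have hφ1 : ContDiff ℝ 1 (deriv φ) := (contDiff_succ_iff_deriv.1 hφ).2.2
  have hc0 : Continuous φ := hφ.continuous
  have hc1 : Continuous (deriv φ) := hφ1.continuous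
  have hd1 : ∀ y, HasDerivAt (deriv φ) (deriv (deriv φ) y) y := fun y => ((hφ1.differentiable one_ne_zero) y).hasDerivAt
  obtain ⟨hI, -⟩ := abs_linForm_le_any (d := d) (V := V) hL hdm hVm hD₁ hd hV hv hc0.aestronglyMeasurable hc1.aestronglyMeasurable hw0 hw1
  -- the multiplier `g = w·φ′` and integration by parts
  set g : ℝ → ℝ := fun y => (L ^ 2 + y ^ 2) * deriv φ y with hg
  have hgC : ContDiff ℝ 1 g := by rw [hg]; exact (by fun_prop : ContDiff ℝ 1 fun y : ℝ => L ^ 2 + y ^ 2).mul hφ1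
  have hgd : ∀ y, deriv g y = 2 * y * deriv φ y + (L ^ 2 + y ^ 2) * deriv (deriv φ) y := by
    intro y
    have hw : HasDerivAt (fun y : ℝ => L ^ 2 + y ^ 2) (2 * y) y := by
      have := ((hasDerivAt_id y).pow 2).const_add (L ^ 2)
      simpa using this
    have h : HasDerivAt (fun y => (L ^ 2 + y ^ 2) * deriv φ y) (2 * y * deriv φ y + (L ^ 2 + y ^ 2) * deriv (deriv φ) y) y := hw.mul (hd1 y)
    rw [hg, h.deriv]
  have hA := integral_deriv_mul_testAny hgC hv
  have hG2 : Integrable fun y => deriv g y * v y := Continuous.integrable_of_hasCompactSupport ((hgC.continuous_deriv le_rfl).mul hvc) hvK.mul_left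
  have key : ∀ y, ((L ^ 2 + y ^ 2) * (deriv φ y * v₁ y) + 2 * y * (deriv φ y * v y) + (L ^ 2 + y ^ 2) * d y * (deriv φ y * v y)
        + (L ^ 2 + y ^ 2) * V y * (φ y * v y))
      - (L ^ 2 + y ^ 2) * ((-deriv (deriv φ) y + d y * deriv φ y + V y * φ y) * v y) = (L ^ 2 + y ^ 2) * deriv φ y * v₁ y + deriv g y * v y := by
    intro y; rw [hgd y]; ring
  have hT : Integrable fun y => (L ^ 2 + y ^ 2) * ((-deriv (deriv φ) y + d y * deriv φ y + V y * φ y) * v y) := by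
    have h := (integrable_weight_mul_any hL (hq.toLp _) hv).1
    refine h.congr ?_
    filter_upwards [ae_volume_of_ae_μw hL (MemLp.coeFn_toLp hq)] with y hy
    rw [hy]
  have hG1 : Integrable fun y => (L ^ 2 + y ^ 2) * deriv φ y * v₁ y := by
    refine ((hI.sub hT).sub hG2).congr (Eventually.of_forall fun y => ?_)
    simp only [Pi.sub_apply]
    linarith [key y]
  have hlin : linForm L d V φ (deriv φ) v v₁ =
      ∫ y, ((L ^ 2 + y ^ 2) * (deriv φ y * v₁ y) + 2 * y * (deriv φ y * v y) + (L ^ 2 + y ^ 2) * d y * (deriv φ y * v y)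
          + (L ^ 2 + y ^ 2) * V y * (φ y * v y)) := rfl
  have eSub := integral_sub hI hT
  have eKey : ∫ y, (((L ^ 2 + y ^ 2) * (deriv φ y * v₁ y) + 2 * y * (deriv φ y * v y) + (L ^ 2 + y ^ 2) * d y * (deriv φ y * v y)
        + (L ^ 2 + y ^ 2) * V y * (φ y * v y))
      - (L ^ 2 + y ^ 2) * ((-deriv (deriv φ) y + d y * deriv φ y + V y * φ y) * v y)) =
      (∫ y, (L ^ 2 + y ^ 2) * deriv φ y * v₁ y) + ∫ y, deriv g y * v y := by
    rw [← integral_add hG1 hG2]; exact integral_congr_ae (Eventually.of_forall key)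
  have hgφ : ∫ y, g y * v₁ y = ∫ y, (L ^ 2 + y ^ 2) * deriv φ y * v₁ y := rfl
  rw [hlin]
  linarith

/-! ### §3 Even zero-mass `C¹` profiles with weights as elements of `EspE`; their `L²_w` class -/

/-- **An even zero-mass `C¹` profile with `∫w φ², ∫w φ′² < ∞` is `profile P` for some `P ∈ EspE`**, with `derE P = φ′` a.e. and `ιEE P` the `L²_w` class of `φ`
(`exists_espE_of_profile` + the fundamental theorem of calculus). [folklore] -/
theorem exists_espE_of_C1 (hL : 0 < L) {φ : ℝ → ℝ} (hφ : ContDiff ℝ 1 φ) (heven : ∀ y, φ (-y) = φ y) (hz : ∫ y, φ y = 0)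
    (hw0 : Integrable fun y => (L ^ 2 + y ^ 2) * φ y ^ 2) (hw1 : Integrable fun y => (L ^ 2 + y ^ 2) * deriv φ y ^ 2) :
    ∃ P : EspE L hL, profile P = φ ∧ derE P =ᵐ[volume] deriv φ ∧ ((ιEE hL P : W L) : ℝ → ℝ) =ᵐ[volume] φ := by
  have hc1 : Continuous (deriv φ) := hφ.continuous_deriv le_rfl
  have hdiff : Differentiable ℝ φ := hφ.differentiable one_ne_zero
  have hprim : ∀ x, φ x = φ 0 + ∫ s in (0 : ℝ)..x, deriv φ s := by
    intro x
    rw [intervalIntegral.integral_deriv_eq_sub (fun y _ => hdiff y) (hc1.intervalIntegrable _ _)]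
    ring
  obtain ⟨P, hP, hder⟩ := exists_espE_of_profile hL hprim heven hc1.aestronglyMeasurable hw0 hw1 hz
  exact ⟨P, hP, hder, (ιEE_ae hL P).trans (Eventually.of_forall fun y => by rw [hP])⟩

/-! ### §4 The domain theorem -/

/-- **EVEN ZERO-MASS `C²` PROFILES WITH WEIGHTED DECAY LIE IN `D(T⁺)`, FOR EVERY (S1⁺) DATUM AND EVERY BASE POINT.** Let `h : GardingDataKE L hL d V K …`,
`Re σ₀ > −m`, and let `φ ∈ C²(ℝ)` be even with `∫ φ = 0` and `∫w φ², ∫w φ′², ∫w (ξφ′)², ∫w φ″² < ∞` (`w = L² + ξ²`); let `g ∈ WevenZ hL` be its `L²_w` class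
(`g = φ` a.e.). Then `realE hL g _ = g + 0i ∈ D(generatorEven hL K h σ₀ _)`: the weak image is the even zero-mass correction of `−φ″ + dφ′ + Vφ + K P`
(`P ∈ EspE` the energy-space element of `φ`), by selfsim's `mem_domain_of_weakE`. In particular any finite coframe sum (rational decay `(L² + ξ²)⁻¹`, derivatives
one order better) qualifies. MODEL statement (1-D sheet linearisation); not NS. [folklore] -/
theorem realE_mem_domain_generatorEven_of_smooth (hL : 0 < L) (K : EspE L hL →L[ℝ] W L) (h : GardingDataKE L hL d V K D₀ D₁ V₀ c m)
    {σ₀ : ℂ} (hσ₀ : -m < σ₀.re) {φ : ℝ → ℝ} (hφ : ContDiff ℝ 2 φ) (heven : ∀ y, φ (-y) = φ y) (hz : ∫ y, φ y = 0)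
    (hw0 : Integrable fun y => (L ^ 2 + y ^ 2) * φ y ^ 2) (hw1 : Integrable fun y => (L ^ 2 + y ^ 2) * deriv φ y ^ 2)
    (hw1' : Integrable fun y => (L ^ 2 + y ^ 2) * (y * deriv φ y) ^ 2) (hw2 : Integrable fun y => (L ^ 2 + y ^ 2) * deriv (deriv φ) y ^ 2)
    {g : W L} (hgφ : (g : ℝ → ℝ) =ᵐ[volume] φ) (hg : g ∈ WevenZ hL) :
    realE hL g hg ∈ (generatorEven hL K h σ₀ hσ₀).domain := by
  obtain ⟨hdm, hVm, hd, hV⟩ : AEStronglyMeasurable d volume ∧ AEStronglyMeasurable V volume ∧ (∀ ξ, |d ξ| ≤ D₀ + D₁ * |ξ|) ∧ ∀ ξ, |V ξ| ≤ V₀ :=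
    ⟨h.d_meas, h.V_meas, h.d_le, h.V_le⟩
  obtain ⟨P, hprof, hder, hιP⟩ := exists_espE_of_C1 hL (hφ.of_le one_le_two) heven hz hw0 hw1
  have hq := memLp_image_of_C2 (L := L) hdm hVm hd hV hφ hw0 hw1 hw1' hw2
  set F₀ : W L := hq.toLp _ + K P with hF₀def
  set ρ : W L := (memLp_invWeight hL).toLp _ with hρdef
  have hρ : (ρ : ℝ → ℝ) =ᵐ[volume] fun y => (L ^ 2 + y ^ 2)⁻¹ := ae_volume_of_ae_μw hL (MemLp.coeFn_toLp _)
  set FR : W L := (1 / 2 : ℝ) • (F₀ + reflW L F₀) - (L / π * massW hL ((1 / 2 : ℝ) • (F₀ + reflW L F₀))) • ρ with hFRdef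
  have hFR : FR ∈ WevenZ hL := evenZ_correction_mem hL F₀ hρ
  -- `g = ιEE P` in `L²_w`, so `realE g = cplxE P` as classes and `toPair (realE g) = ιpairE (P, 0)`
  have hgP : g = ιEE hL P := Lp.ext (ae_μw_of_ae_volume (hgφ.trans hιP.symm))
  have hpair : toPair L (realE hL g hg : Wc L) = ιpairE hL (WithLp.toLp 2 (P, (0 : EspE L hL))) := by
    rw [coe_realE, hgP, ← (coe_cplxE hL P).1]
    exact (coe_cplxE hL P).2
  refine (mem_domain_of_weakE hL K h hσ₀ (u := realE hL g hg) (F := realE hL FR hFR) (P := WithLp.toLp 2 (P, (0 : EspE L hL))) hpair ?_).1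
  -- the weak image identity on zero-mass even tests
  have hre : reW L (realE hL FR hFR : Wc L) = FR := by rw [coe_realE]; exact (reW_imW_ofRealW (L := L) FR).1
  have him : imW L (realE hL FR hFR : Wc L) = 0 := by rw [coe_realE]; exact (reW_imW_ofRealW (L := L) FR).2
  intro v v₁ hv hv0
  have hfst : (WithLp.toLp 2 (P, (0 : EspE L hL))).fst = P := rfl
  have hsnd : (WithLp.toLp 2 (P, (0 : EspE L hL))).snd = 0 := rfl
  set wq : testSpaceE0 := ⟨(v, v₁), hv, hv0⟩ with hwq
  rw [hfst, hsnd, hre, him]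
  refine ⟨?_, ?_⟩
  · -- first component: linForm(φ) + ∫ w (K P) v = ∫ w FR v = ∫ w F₀ v = ∫ w q v + ∫ w (K P) v
    have hlinp : linForm L d V (profile P) (derE P) v v₁ = linForm L d V φ (deriv φ) v v₁ :=
      linForm_congr_ae L d V (Eventually.of_forall fun y => by rw [hprof]) hder
    rw [hlinp, linForm_eq_integral_of_C2 hL hdm hVm h.D₁_nonneg hd hV hφ hw0 hw1 hq hv.toIsCompactTestAny, hFRdef,
      integral_weight_correction_mul_test hL F₀ hρ hv hv0, hF₀def, ← PdataE_apply hL (hq.toLp _ + K P) wq, map_add (PdataE hL),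
      LinearMap.add_apply, PdataE_apply hL _ wq, PdataE_apply hL _ wq]
    show (∫ y, (L ^ 2 + y ^ 2) * ((-deriv (deriv φ) y + d y * deriv φ y + V y * φ y) * v y)) + _ =
      (∫ y, (L ^ 2 + y ^ 2) * (((hq.toLp _ : W L) : ℝ → ℝ) y * v y)) + _
    congr 1
    refine integral_congr_ae ?_
    filter_upwards [ae_volume_of_ae_μw hL (MemLp.coeFn_toLp hq)] with y hy
    rw [hy]
  · -- second component: everything vanishes
    have hzero : linForm L d V (profile (0 : EspE L hL)) (derE (0 : EspE L hL)) v v₁ = 0 := by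
      have e := (EformE_apply hL hdm hVm h.D₁_nonneg hd hV (0 : EspE L hL) wq).symm
      rw [map_zero, LinearMap.zero_apply] at e
      exact e
    rw [hzero, map_zero, ← PdataE_apply hL (0 : W L) wq, map_zero, LinearMap.zero_apply]
    simp

/-- **Base-point-free packaging with the eigen-equation base point of the even assembly** (`σ₀ = 1/2`, as in the binder `hdom` of
`SheetRLinearisedStabilityEvenEndToEnd.flow_stable_even_of_centre`): same statement at `1/2` for a datum with `−m < 1/2`. [folklore] -/
theorem realE_mem_domain_generatorEven_half_of_smooth (hL : 0 < L) (K : EspE L hL →L[ℝ] W L) (h : GardingDataKE L hL d V K D₀ D₁ V₀ c m)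
    (hm : -m < ((1 : ℂ) / 2).re) {φ : ℝ → ℝ} (hφ : ContDiff ℝ 2 φ) (heven : ∀ y, φ (-y) = φ y) (hz : ∫ y, φ y = 0)
    (hw0 : Integrable fun y => (L ^ 2 + y ^ 2) * φ y ^ 2) (hw1 : Integrable fun y => (L ^ 2 + y ^ 2) * deriv φ y ^ 2)
    (hw1' : Integrable fun y => (L ^ 2 + y ^ 2) * (y * deriv φ y) ^ 2) (hw2 : Integrable fun y => (L ^ 2 + y ^ 2) * deriv (deriv φ) y ^ 2)
    {g : W L} (hgφ : (g : ℝ → ℝ) =ᵐ[volume] φ) (hg : g ∈ WevenZ hL) :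
    realE hL g hg ∈ (generatorEven hL K h ((1 : ℂ) / 2) hm).domain :=
  realE_mem_domain_generatorEven_of_smooth hL K h hm hφ heven hz hw0 hw1 hw1' hw2 hgφ hg

end SheetRGeneratorEvenSmoothDomain
end Summit.NavierStokesRegularity.OSWSelfSimilar

end
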